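import Summits.AtomisticToContinuum.Crystallization.Theorems.PalmUnimodularRigidityShellsToBarlowChartQuotientGrowth

/-!
# Combinatorial layering (B1a of `GapTwelveToBarlow`): coordinates of nearby model points

Crux `SquareWellLayerCake.GapTwelveToBarlow` (stmt-AtomisticToContinuum-15807), line `Sketch`,
stub `stub_develop` (H_develop), metric closure step (c): the ideal ball about a covered model
point lies in the covered coordinate diamond.  In the model `barlowStacking 1 √(2/3) s` (`s` a
Hägg word) a point at distance `≤ r` from `barlowPos … k₀ i₀ j₀` has coordinates `(k, i, j)` with
`|k − k₀| ≤ (5/4) r` and `|j − j₀| + |i − i₀| + 3|k − k₀| ≤ 8 r` (`coords_of_dist_le`, anchor), from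
the coordinate formula `dist_barlowPos_sq` and the drift bound `|L(k) − L(k₀)| ≤ |k − k₀|` of the
lateral letter offset (`QuotientGrowth.abs_haggLabel_sub_le` of the 9227 files).  Constants are crude (true: `1.23 r`, `≈ 4.4 r`);
they only enter the existential window constant.  Nothing is defined; no named fact is used.
-/

noncomputable section

namespace Summit.AtomisticToContinuum.Crystallization.Theorems.SquareWellLayerCakeGapTwelveToBarlow

open Literature.MathematicalPhysics.StatisticalMechanics
open Summit.AtomisticToContinuum.Crystallization.Theorems.PalmUnimodularRigidityShellsToBarlowChart (QuotientGrowth.abs_haggLabel_sub_le)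

/-- The real inequalities behind `coords_of_dist_le`: if
`A² + (3/4) B² + (2/3) C² ≤ r²` with `A = Δi + Δj/2 + ΔL/2`, `B = Δj + ΔL/3`, `C = Δk` and
`|ΔL| ≤ |Δk|`, then `|Δk| ≤ (5/4) r`, `|Δj| ≤ (33/20) r`, `|Δi| ≤ (5/2) r`. [folklore] -/
theorem coord_bounds_real {di dj dk dL r : ℝ} (hr : 0 ≤ r)
    (h : (di + dj / 2 + dL / 2) ^ 2 + 3 / 4 * (dj + dL / 3) ^ 2 + 2 / 3 * dk ^ 2 ≤ r ^ 2)
    (hL : |dL| ≤ |dk|) : |dk| ≤ 5 / 4 * r ∧ |dj| ≤ 33 / 20 * r ∧ |di| ≤ 5 / 2 * r := by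
  have hA2 : (di + dj / 2 + dL / 2) ^ 2 ≤ r ^ 2 := by
    nlinarith [sq_nonneg (dj + dL / 3), sq_nonneg dk]
  have hB2 : (dj + dL / 3) ^ 2 ≤ (6 / 5 * r) ^ 2 := by
    nlinarith [sq_nonneg (di + dj / 2 + dL / 2), sq_nonneg dk]
  have hC2 : dk ^ 2 ≤ (5 / 4 * r) ^ 2 := by
    nlinarith [sq_nonneg (di + dj / 2 + dL / 2), sq_nonneg (dj + dL / 3)]
  have hAa : |di + dj / 2 + dL / 2| ≤ r := abs_le_of_sq_le_sq hA2 hr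
  have hBa : |dj + dL / 3| ≤ 6 / 5 * r := abs_le_of_sq_le_sq hB2 (by positivity)
  have hCa : |dk| ≤ 5 / 4 * r := abs_le_of_sq_le_sq hC2 (by positivity)
  have hLr : |dL| ≤ 5 / 4 * r := hL.trans hCa
  have hj : |dj| ≤ 33 / 20 * r := by
    rw [abs_le] at hBa hLr ⊢
    constructor <;> linarith [hBa.1, hBa.2, hLr.1, hLr.2]
  have hi : |di| ≤ 5 / 2 * r := by
    rw [abs_le] at hAa hj hLr ⊢
    constructor <;> linarith [hAa.1, hAa.2, hj.1, hj.2, hLr.1, hLr.2]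
  exact ⟨hCa, hj, hi⟩

/-- **Coordinates of nearby model points** (anchor of this file). [folklore] -/
theorem coords_of_dist_le :
    ∀ (s : ℤ → ℤ) (k₀ i₀ j₀ k i j : ℤ) (r : ℝ) (M₁ M₂ : ℕ), IsHaggSeq s → dist (barlowPos 1
    (Real.sqrt (2 / 3)) s k i j) (barlowPos 1 (Real.sqrt (2 / 3)) s k₀ i₀ j₀) ≤ r → 5 / 4 * r ≤
    (M₁ : ℝ) → 8 * r ≤ (M₂ : ℝ) → (k - k₀).natAbs ≤ M₁ ∧ (j - j₀).natAbs + (i - i₀).natAbs + 3 * (k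
    - k₀).natAbs ≤ M₂ := by
  intro s k₀ i₀ j₀ k i j r M₁ M₂ hs hd hM₁ hM₂
  have hr : 0 ≤ r := dist_nonneg.trans hd
  have hsq := dist_barlowPos_sq 1 (Real.sqrt (2 / 3)) s k i j k₀ i₀ j₀
  have hd2 : dist (barlowPos 1 (Real.sqrt (2 / 3)) s k i j)
      (barlowPos 1 (Real.sqrt (2 / 3)) s k₀ i₀ j₀) ^ 2 ≤ r ^ 2 := pow_le_pow_left₀ dist_nonneg hd 2
  have h23 : Real.sqrt (2 / 3) ^ 2 = 2 / 3 := Real.sq_sqrt (by norm_num)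
  have h3 : Real.sqrt 3 ^ 2 = 3 := Real.sq_sqrt (by norm_num)
  have key : (((i : ℝ) - i₀) + ((j : ℝ) - j₀) / 2 + ((haggLabel s k : ℝ) - haggLabel s k₀) / 2) ^ 2 +
      3 / 4 * (((j : ℝ) - j₀) + ((haggLabel s k : ℝ) - haggLabel s k₀) / 3) ^ 2 +
      2 / 3 * ((k : ℝ) - k₀) ^ 2 ≤ r ^ 2 := by
    have e : (((i : ℝ) - i₀) + ((j : ℝ) - j₀) / 2 + ((haggLabel s k : ℝ) - haggLabel s k₀) / 2) ^ 2 +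
        3 / 4 * (((j : ℝ) - j₀) + ((haggLabel s k : ℝ) - haggLabel s k₀) / 3) ^ 2 +
        2 / 3 * ((k : ℝ) - k₀) ^ 2 =
        (1 * (((i : ℝ) - i₀) + ((j : ℝ) - j₀) / 2 + ((haggLabel s k : ℝ) - haggLabel s k₀) / 2)) ^ 2 +
        (1 * Real.sqrt 3 / 2 * (((j : ℝ) - j₀) + ((haggLabel s k : ℝ) - haggLabel s k₀) / 3)) ^ 2 +
        (((k : ℝ) - k₀) * Real.sqrt (2 / 3)) ^ 2 := by
      rw [mul_pow (((k : ℝ) - k₀)), h23, one_mul, mul_pow, div_pow, mul_pow, h3]; ring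
    rw [e, ← hsq]; exact hd2
  have hL : |(haggLabel s k : ℝ) - haggLabel s k₀| ≤ |(k : ℝ) - k₀| := by
    exact_mod_cast QuotientGrowth.abs_haggLabel_sub_le hs k k₀
  obtain ⟨hk, hj, hi⟩ := coord_bounds_real hr key hL
  -- back to natural numbers
  have ck : (((k - k₀).natAbs : ℕ) : ℝ) = |(k : ℝ) - k₀| := by
    rw [← Int.cast_natCast, Int.natCast_natAbs, Int.cast_abs, Int.cast_sub]
  have cj : (((j - j₀).natAbs : ℕ) : ℝ) = |(j : ℝ) - j₀| := by
    rw [← Int.cast_natCast, Int.natCast_natAbs, Int.cast_abs, Int.cast_sub]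
  have ci : (((i - i₀).natAbs : ℕ) : ℝ) = |(i : ℝ) - i₀| := by
    rw [← Int.cast_natCast, Int.natCast_natAbs, Int.cast_abs, Int.cast_sub]
  constructor
  · have : (((k - k₀).natAbs : ℕ) : ℝ) ≤ M₁ := by rw [ck]; linarith
    exact_mod_cast this
  · have : (((j - j₀).natAbs + (i - i₀).natAbs + 3 * (k - k₀).natAbs : ℕ) : ℝ) ≤ M₂ := by
      push_cast; rw [ck, cj, ci]; linarith
    exact_mod_cast this

end Summit.AtomisticToContinuum.Crystallization.Theorems.SquareWellLayerCakeGapTwelveToBarlow
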